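import Summits.ResolutionOfSingularities.ResolutionOfSingularities.Theorems.PurelyInseparableDim4JointForestRootWaiting
import Summits.ResolutionOfSingularities.ResolutionOfSingularities.Theorems.PurelyInseparableDim4JointTwoChartComputations
import HarnessLib

/-!
# Purely inseparable four-folds: two INTERSECTING 3-FOLDS of the root locus — `z^p + x₁^p x₂^p x₃` certified by the v3-lite
# forest, every `p` (brick S3 (c) «joint point∘coordinate chains», part 40 = instance inst₁₂; cell `res-dim4-pi`)

[OURS · counted 0] (D-0157 DOOR 2; desk WORD #66 (4)(c), #74 (g), #99 (d); frame `PIDim4.TerminationImpliesOrderReduction`,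
S3 (c) v3-lite, memo `S3c-V3-DESIGN.md` Addendum 1 (2.); host item stmt-ResolutionOfSingularities-16155, helper). Nothing here
proves resolution of singularities in dimension ≥ 4 / characteristic `p` — NOT here, not anywhere in this programme.

`F = x₁^p x₂^p x₃` over `K = K̄` of characteristic `p` (variables `x₁…x₄` = `X 0…X 3`). The order-`p` locus of `z^p + F` is the
union of the two 3-FOLDS `V(z, x₁)` and `V(z, x₂)` (`roots_threefolds`: `∂F/∂x₃ = x₁^p x₂^p`), meeting along a surface — the memo's
example of an intersecting root locus. v3-lite: HOST `(0, S₀ = {x₁})`, WAITING ENTRY `(x₁, 0, T = {x₂})` (`S₀ ∖ {x₁} = ∅ ⊆ T ∌ x₁`);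
blowing up the host leaves on its only chart `x₁` the state `x₂^p x₃` (`step_threefolds`), whose equimultiple pairs are exactly
`{y₂ = 0}` (`eq_zero_of_isEquimultiplePoint_threefolds`) = the waiting kid `V(z′, y₂)` over the host; blowing that up reads `x₃` on its
chart — DEAD (`not_isEquimultiplePoint_T_threefolds`). Two blow-ups with 3-fold centres, no leaves, every `p`:

* §1 computations (`threefolds_eq_monomial`, cleanness, permissibility of `{x₁}` and `{x₂}`, roots, charts, step, deadness);
* §2 **`exists_isMarkedResolution_inst₁₂`** — `(𝔸⁵_K, (z^p + x₁^p x₂^p x₃)·𝒪, [], p)` admits a marked resolution (BGMW Def. 3.1.3),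
  by part 38 with `Pl₀ = ∅`, `Wt = {(x₁, 0, {x₂})}`, `L₀ = ∅`. UNCONDITIONAL, every `p`.

AI-produced formalisation, weaker than expert review. bears_on: LADDER-RESOLUTION:D157-DOOR2 (res-dim4-pi · S3 (c) joint v3-lite ·
two 3-folds instance).
-/

set_option linter.dupNamespace false -- D-0017: single-problem summit path `Summit.<S>.<S>.…` by design

noncomputable section

open MvPolynomial Finset CategoryTheory AlgebraicGeometry Opposite TopologicalSpace

namespace Summit.ResolutionOfSingularities.ResolutionOfSingularities.Theorems.PIDim4

open Literature.AlgebraicGeometry.Resolution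
open Literature.AlgebraicGeometry.Resolution.Hauser2010
open Literature.AlgebraicGeometry.Resolution.AffinePointBlowup (P A γ coord Wtop ξ)

namespace Equimultiple

section Instance₁₂

variable {K : Type} [Field K] {p : ℕ} [hp : Fact p.Prime] [CharP K p]

/-! ## §1 Computations -/

omit hp [CharP K p] in
/-- `F = x₁^p x₂^p x₃` is one monomial. [folklore] -/
theorem threefolds_eq_monomial :
    (X 0 ^ p * X 1 ^ p * X 2 : MvPolynomial (Fin 4) K) =
      monomial (Finsupp.single 0 p + Finsupp.single 1 p + Finsupp.single 2 1) 1 := by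
  rw [X_pow_eq_monomial, X_pow_eq_monomial, X, monomial_mul, monomial_mul, mul_one, mul_one]

omit hp [CharP K p] in
/-- The support of `F` is its exponent. [folklore] -/
theorem mem_support_threefolds {d : Fin 4 →₀ ℕ} (hd : d ∈ (X 0 ^ p * X 1 ^ p * X 2 : MvPolynomial (Fin 4) K).support) :
    d = Finsupp.single 0 p + Finsupp.single 1 p + Finsupp.single 2 1 := by
  rw [threefolds_eq_monomial] at hd
  exact Finset.mem_singleton.mp (Finset.mem_of_subset support_monomial_subset hd)

omit [CharP K p] in
/-- `F` is clean (exponent `1` of `x₃`). [cite: HauserPerlega2019PRIMS, §2 (cleaning)] -/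
theorem isClean_threefolds :
    Literature.Barriers.ResolutionOfSingularities.HauserPerlega.IsClean p (X 0 ^ p * X 1 ^ p * X 2 : MvPolynomial (Fin 4) K) := by
  intro d hd hpth
  rw [mem_support_threefolds hd] at hpth
  have h := hpth 2 (by simp)
  simp only [Finsupp.coe_add, Pi.add_apply, Finsupp.single_eq_same] at h
  rw [Finsupp.single_eq_of_ne (by decide), Finsupp.single_eq_of_ne (by decide), zero_add, zero_add] at h
  exact hp.out.one_lt.ne' (Nat.dvd_one.mp h)

omit hp [CharP K p] in
/-- `F ≠ 0`. [folklore] -/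
theorem threefolds_ne_zero : (X 0 ^ p * X 1 ^ p * X 2 : MvPolynomial (Fin 4) K) ≠ 0 := by
  rw [threefolds_eq_monomial]
  exact monomial_eq_zero.not.mpr one_ne_zero

omit hp [CharP K p] in
/-- **`V(z, x₁)` is Hironaka-permissible for `z^p + F`** (the host). [cite: HauserPerlega2019PRIMS, §2 (condition (1))] -/
theorem isPermissibleCentre_S_threefolds :
    IsPermissibleCentre p ({0} : Finset (Fin 4)) (X 0 ^ p * X 1 ^ p * X 2 : MvPolynomial (Fin 4) K) := by
  refine ⟨⟨0, Finset.mem_singleton_self _⟩, Finset.le_inf fun d hd => ?_⟩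
  rw [mem_support_threefolds hd]
  simp [CentreBlowup.degIn_singleton]

omit hp [CharP K p] in
/-- **`V(z, x₂)` is Hironaka-permissible for `z^p + F`** (the waiting member). [cite: HauserPerlega2019PRIMS, §2 (condition (1))] -/
theorem isPermissibleCentre_T_threefolds :
    IsPermissibleCentre p ({1} : Finset (Fin 4)) (X 0 ^ p * X 1 ^ p * X 2 : MvPolynomial (Fin 4) K) := by
  refine ⟨⟨1, Finset.mem_singleton_self _⟩, Finset.le_inf fun d hd => ?_⟩
  rw [mem_support_threefolds hd]
  simp [CentreBlowup.degIn_singleton]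

omit [CharP K p] in
/-- **The root parameters**: order `p` at `(a, b)` forces `b₁ = 0 ∨ b₂ = 0` (`∂F/∂x₃ = x₁^p x₂^p`) — the two INTERSECTING
3-folds. [cite: Hauser2010, §F (equiconstant points)] -/
theorem roots_threefolds (b : Fin 4 → K)
    (H : ∀ d : Fin 4 →₀ ℕ, d ≠ 0 → d.degree < p →
      coeff d (PointBlowup.translate b (X 0 ^ p * X 1 ^ p * X 2 : MvPolynomial (Fin 4) K)) = 0) :
    b 0 = 0 ∨ b 1 = 0 := by
  have hp0 : p ≠ 0 := hp.out.ne_zero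
  have h2 := eval_pderiv_eq_zero_of_forall_coeff b _ H 2
  simp [(pderiv (2 : Fin 4)).leibniz_pow, hp0] at h2
  exact h2

omit hp [CharP K p] in
/-- **The `x₁`-chart of the blow-up of the host reads `y₂^p y₃`.** [cite: HauserPerlega2019PRIMS, §2 (the x₁-chart)] -/
theorem chartTransform_S_threefolds :
    CentreBlowup.chartTransform p ({0} : Finset (Fin 4)) 0 (X 0 ^ p * X 1 ^ p * X 2 : MvPolynomial (Fin 4) K) =
      X 1 ^ p * X 2 := by
  rw [threefolds_eq_monomial, CentreBlowup.chartTransform_monomial]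
  simp only [CentreBlowup.chartExponent, CentreBlowup.degIn_singleton]
  have e1 : (Finsupp.single 0 p + Finsupp.single 1 p + Finsupp.single 2 1 : Fin 4 →₀ ℕ).update 0
      ((Finsupp.single 0 p + Finsupp.single 1 p + Finsupp.single 2 1 : Fin 4 →₀ ℕ) 0 - p) =
        Finsupp.single 1 p + Finsupp.single 2 1 := by
    ext i; fin_cases i <;> simp [Finsupp.update_apply]
  rw [e1, ← X_pow_mul_X_eq_monomial]

omit [CharP K p] in
/-- `y₂^p y₃` is clean. [cite: HauserPerlega2019PRIMS, §2 (cleaning)] -/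
theorem isClean_H_threefolds :
    Literature.Barriers.ResolutionOfSingularities.HauserPerlega.IsClean p (X 1 ^ p * X 2 : MvPolynomial (Fin 4) K) := by
  intro d hd hpth
  rw [X_pow_mul_X_eq_monomial] at hd
  have hd' := Finset.mem_singleton.mp (Finset.mem_of_subset support_monomial_subset hd)
  rw [hd'] at hpth
  have h := hpth 2 (by simp)
  simp only [Finsupp.coe_add, Pi.add_apply, Finsupp.single_eq_same] at h
  rw [Finsupp.single_eq_of_ne (by decide), zero_add] at h
  exact hp.out.one_lt.ne' (Nat.dvd_one.mp h)

omit [CharP K p] in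
/-- **The equimultiple pairs of the host's chart lie on the waiting kid**: `b₂ = 0` (the linear coefficient of `y₃` is `b₂^p`).
[cite: Hauser2010, §F (equiconstant points)] -/
theorem eq_zero_of_isEquimultiplePoint_threefolds [DecidableEq K] {b : Fin 4 → K} (s : State K)
    (hs : s.F = X 0 ^ p * X 1 ^ p * X 2) (h : CentreBlowup.IsEquimultiplePoint p ({0} : Finset (Fin 4)) 0 b s) :
    b 1 = 0 := by
  have hp0 : p ≠ 0 := hp.out.ne_zero
  unfold CentreBlowup.IsEquimultiplePoint CentreBlowup.pointTransform at h
  rw [hs, chartTransform_S_threefolds] at h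
  have h2 := eval_pderiv_eq_zero_of_forall_coeff b _ h 2
  simp [(pderiv (2 : Fin 4)).leibniz_pow, hp0] at h2
  exact h2

omit [CharP K p] in
/-- **The waiting entry's state**: `(step p {x₁} x₁ 0 (F, 0, ∅)).F = y₂^p y₃` (already clean). [cite: Hauser2010, §§F–G] -/
theorem step_threefolds [DecidableEq K] :
    (CentreBlowup.step p ({0} : Finset (Fin 4)) 0 (0 : Fin 4 → K)
        (⟨X 0 ^ p * X 1 ^ p * X 2, 0, ∅⟩ : State K)).F = X 1 ^ p * X 2 := by
  show deletePthPowers p (PointBlowup.translate (0 : Fin 4 → K)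
    (CentreBlowup.chartTransform p ({0} : Finset (Fin 4)) 0 (X 0 ^ p * X 1 ^ p * X 2 : MvPolynomial (Fin 4) K))) = _
  rw [chartTransform_S_threefolds, PointBlowup.translate_zero]
  exact Literature.Barriers.ResolutionOfSingularities.HauserPerlega.deletePthPowers_eq_self isClean_H_threefolds

omit hp [CharP K p] in
/-- **The `y₂`-chart of the blow-up of the waiting kid `V(z′, y₂)` applied to `y₂^p y₃` reads `y₃`.**
[cite: HauserPerlega2019PRIMS, §2 (the x₁-chart)] -/
theorem chartTransform_T_threefolds :
    CentreBlowup.chartTransform p ({1} : Finset (Fin 4)) 1 (X 1 ^ p * X 2 : MvPolynomial (Fin 4) K) = X 2 := by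
  rw [X_pow_mul_X_eq_monomial, CentreBlowup.chartTransform_monomial]
  simp only [CentreBlowup.chartExponent, CentreBlowup.degIn_singleton]
  have e1 : (Finsupp.single 1 p + Finsupp.single 2 1 : Fin 4 →₀ ℕ).update 1
      ((Finsupp.single 1 p + Finsupp.single 2 1 : Fin 4 →₀ ℕ) 1 - p) = Finsupp.single 2 1 := by
    ext i; fin_cases i <;> simp [Finsupp.update_apply]
  rw [e1]
  rfl

omit [CharP K p] in
/-- **THE WAITING KID'S BLOW-UP IS DEAD**: `y₃` is linear. [cite: Hauser2010, §F (equiconstant points)] -/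
theorem not_isEquimultiplePoint_T_threefolds [DecidableEq K] {k : Fin 4} (hk : k ∈ ({1} : Finset (Fin 4))) (b : Fin 4 → K)
    (s : State K) (hs : s.F = X 1 ^ p * X 2) : ¬ CentreBlowup.IsEquimultiplePoint p ({1} : Finset (Fin 4)) k b s := by
  have hk' : k = 1 := Finset.mem_singleton.mp hk
  subst hk'
  intro h
  unfold CentreBlowup.IsEquimultiplePoint CentreBlowup.pointTransform at h
  rw [hs, chartTransform_T_threefolds] at h
  have h2 := h (Finsupp.single 2 1) (Finsupp.single_ne_zero.mpr one_ne_zero) (by rw [Finsupp.degree_single]; exact hp.out.one_lt)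
  rw [coeff_single_one_translate] at h2
  simp at h2

/-! ## §2 The certificate -/

/-- **TWO INTERSECTING 3-FOLDS, CERTIFIED** (every `p`): `(𝔸⁵_K, (z^p + x₁^p x₂^p x₃)·𝒪, [], p)` admits a marked resolution — host
`V(z, x₁)` blown up first while `V(z, x₂)` waits, then the waiting kid `V(z′, y₂)`; nothing of order `p` survives.
[cite: BierstoneGrigorievMilmanWlodarczyk2011, Def. 3.1.3] [cite: HauserPerlega2019PRIMS, §2 (permissible centres P = (z, x_i : i ∈ Γ))]
[cite: Hauser2010, §F (equiconstant points)] -/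
theorem exists_isMarkedResolution_inst₁₂ [IsAlgClosed K] [DecidableEq K] :
    ∃ (X' : Scheme.{0}) (ρ : X' ⟶ P 4 K) (M' : MarkedIdeal X'),
      IsMarkedResolution (⟨hypSheaf p (X 0 ^ p * X 1 ^ p * X 2 : MvPolynomial (Fin 4) K), [], p⟩ : MarkedIdeal (P 4 K)) ρ M' := by
  classical
  set F : MvPolynomial (Fin 4) K := X 0 ^ p * X 1 ^ p * X 2 with hFdef
  set s₀ : State K := ⟨F, 0, ∅⟩ with hs₀def
  have hs₀ : s₀ = ⟨deletePthPowers p (PointBlowup.translate (0 : Fin 4 → K) F), 0, ∅⟩ := by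
    rw [PointBlowup.translate_zero,
      Literature.Barriers.ResolutionOfSingularities.HauserPerlega.deletePthPowers_eq_self isClean_threefolds]
  -- the waiting entry `(x₁, 0, {x₂})` and its kid pair
  set wt₀ : Fin 4 × (Fin 4 → K) × Finset (Fin 4) := ((0 : Fin 4), (0 : Fin 4 → K), ({1} : Finset (Fin 4))) with hwt₀
  set w₁ : State K × Finset (Fin 4) :=
    (CentreBlowup.step p ({0} : Finset (Fin 4)) 0 (0 : Fin 4 → K) s₀, ({1} : Finset (Fin 4))) with hw₁
  have hH : (CentreBlowup.step p ({0} : Finset (Fin 4)) 0 (0 : Fin 4 → K) s₀).F = X 1 ^ p * X 2 := by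
    rw [hs₀def, hFdef]; exact step_threefolds
  -- the rules below: nothing planned, no leaves
  let plan : State K → Finset (Fin 4) → Finset (Fin 4 × (Fin 4 → K) × Finset (Fin 4)) := fun _ _ => ∅
  let leaves : State K → Finset (Fin 4) → Finset (Fin 4 × (Fin 4 → K)) := fun _ _ => ∅
  have hreach : ∀ q : State K × Finset (Fin 4),
      Relation.ReflTransGen (fun q q' : State K × Finset (Fin 4) =>
        ∃ e ∈ plan q.1 q.2, q' = (CentreBlowup.step p q.2 e.1 e.2.1 q.1, e.2.2)) w₁ q → q = w₁ := by
    intro q hq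
    induction hq with
    | refl => rfl
    | tail _ hR _ =>
      obtain ⟨e, he, -⟩ := hR
      exact absurd he (Finset.notMem_empty e)
  refine exists_isMarkedResolution_joint_forest_root_waiting (p := p) F threefolds_ne_zero isClean_threefolds plan leaves 0
    ({0} : Finset (Fin 4)) s₀ hs₀ isPermissibleCentre_S_threefolds ∅ {wt₀} ∅
    (fun e he => absurd he (Finset.notMem_empty e)) (fun e he => absurd he (Finset.notMem_empty e))
    (fun wt hwt => ?_) (fun wt hwt wt' hwt' hne => ?_) (fun e he => absurd he (Finset.notMem_empty e))
    (fun l hl => absurd hl (Finset.notMem_empty l)) (fun j' b' hj' hb' _ heq => ?_) (fun q hq => ?_)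
    (fun e he => absurd he (Finset.notMem_empty e)) (fun wt hwt => ?_) (fun b' H => ?_)
  · -- the waiting entry is admissible
    rw [Finset.mem_singleton] at hwt
    subst hwt
    refine ⟨by simp [hwt₀], fun i _ => rfl,
      by show (({0} : Finset (Fin 4)).erase 0) ⊆ ({1} : Finset (Fin 4)); decide,
      by show (0 : Fin 4) ∉ ({1} : Finset (Fin 4)); decide, ?_⟩
    change IsPermissibleCentre p ({1} : Finset (Fin 4)) (PointBlowup.translate (0 : Fin 4 → K) F)
    rw [PointBlowup.translate_zero, hFdef]
    exact isPermissibleCentre_T_threefolds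
  · -- one waiting entry only
    rw [Finset.mem_singleton] at hwt hwt'
    exact absurd (hwt.trans hwt'.symm) hne
  · -- the three-way cover over the host: every equimultiple pair lies on the waiting kid
    have hj0 : j' = 0 := Finset.mem_singleton.mp hj'
    subst hj0
    have hb1 : b' 1 = 0 := eq_zero_of_isEquimultiplePoint_threefolds s₀ rfl heq
    refine Or.inr (Or.inl ⟨wt₀, Finset.mem_singleton_self _, rfl, fun i hi => ?_⟩)
    change i ∈ ({1} : Finset (Fin 4)) at hi
    rw [Finset.mem_singleton] at hi
    subst hi
    rw [hb1]; rfl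
  · -- below the waiting kid: dead
    rcases hq with ⟨e, he, -⟩ | ⟨wt, hwt, hq⟩
    · exact absurd he (Finset.notMem_empty e)
    · rw [Finset.mem_singleton] at hwt
      subst hwt
      have hqw : q = w₁ := hreach q hq
      subst hqw
      refine ⟨fun e he => absurd he (Finset.notMem_empty e), fun e he => absurd he (Finset.notMem_empty e),
        fun l hl => absurd hl (Finset.notMem_empty l), fun j'' b'' hj'' hb'' _ heq => ?_⟩
      exact absurd heq (not_isEquimultiplePoint_T_threefolds hj'' b'' _ hH)
  · -- `Acc` below the waiting kid: no move
    exact Acc.intro _ fun q' ⟨e, he, _⟩ => absurd he (Finset.notMem_empty e)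
  · -- the root cover: `b₁ = 0` (the host) or `b₂ = 0` (the waiting member)
    rcases roots_threefolds b' H with hb0 | hb1
    · left
      intro i hi
      rw [Finset.mem_singleton] at hi
      subst hi
      rw [hb0]; rfl
    · right
      refine ⟨wt₀, Finset.mem_singleton_self _, fun i hi => ?_⟩
      change i ∈ ({1} : Finset (Fin 4)) at hi
      rw [Finset.mem_singleton] at hi
      subst hi
      rw [hb1]; simp [hwt₀]

end Instance₁₂

end Equimultiple

end Summit.ResolutionOfSingularities.ResolutionOfSingularities.Theorems.PIDim4

end
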